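import Literature.NumberTheory.Sieve.BombieriFriedlanderIwaniecBilinearProofs
import HarnessLib

/-!
# Bombieri–Friedlander–Iwaniec 1986, Theorem 0 (a): Barban–Davenport–Halberstam under (A₂), PROVED

Sibling proofs file of `Literature.NumberTheory.Sieve.BombieriFriedlanderIwaniecDispersion`, which
vendors the dispersion-method Theorems 1, 2, 5, 5* of E. Bombieri, J. B. Friedlander, H. Iwaniec,
*Primes in arithmetic progressions to large moduli*, Acta Math. 156 (1986), 203–251, as named
facts.  The printed proofs of Theorems 1–4 share §§3–7 (Linnik's dispersion `𝒢 ≤ 𝒮₁ − 2𝒮₂ + 𝒮₃`,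
the evaluation of `𝒮₃`, `𝒮₂`, `𝒮₁`) and differ only in the treatment of `ℛ₁` (§§8–11, resting on
the Deshouillers–Iwaniec bounds for sums of Kloosterman sums, Lemma 1, which neither Mathlib nor
the tree has).  §7 ("Evaluation of `𝒳`", p. 222: "This result is essentially of the type of the
Barban–Davenport–Halberstam theorem and rests on Theorem 0") consumes **Theorem 0 (a)** of the
paper in the form (7.2).  This file PROVES Theorem 0 (a) — the first input of that common trunk
that the tree lacked (Theorem 0 (b), Lemma 3 = Shiu's theorem and the Weil bound being proved in
`…BilinearProofs`, `ShiuBrunTitchmarshProofs`, `LFunctions.KloostermanWeilPrimeProofs`).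
Everything here is PROVED; no named fact is introduced.

* `Literature.NumberTheory.Sieve.BFI.sum_sq_classDisc_eq` — Parseval on the reduced classes
  (p. 212, "The left-hand side of (2.2) is just `S = ∑_q φ(q)⁻¹ ∑_{χ ≠ χ₀} |∑_n β_n χ(n)|²`"):
  `∑_{(l,q)=1} (∑_{n≡l (q)} b_n − φ(q)⁻¹ ∑_{(n,q)=1} b_n)² = φ(q)⁻¹ ∑_{χ ≠ χ₀} |∑_n b_n χ(n)|²`, with
  its ingredients `BFI.classDisc_eq_sum_char` (orthogonality), `BFI.sum_filter_coprime_mul_classSum`,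
  `BFI.sum_filter_coprime_char_eq_zero`, `BFI.char_inv_natCast_eq_conj`, `BFI.sum_mul_one_char`.
* `Literature.NumberTheory.Sieve.BFI.sum_inv_totient_sum_char_le_main` — the skeleton (2.3)–(2.7)
  of the proof of Theorem 0 entered at the character sum
  `∑_{q ≤ Q} φ(q)⁻¹ ∑_{χ ≠ χ₀} |∑ α_m χ(m)| |∑ β_n χ(n)|` (one step before
  `BFI.sum_abs_bilinDisc_le_main` of `…BilinearProofs`, whose Steps 2–5 it reuses verbatim), with
  the small-conductor input abstracted as a constant `R`.
* `Literature.NumberTheory.Sieve.BombieriFriedlanderIwaniecTheorem0a` — **Theorem 0 (a)** in the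
  form (7.2) used in §7 (sums restricted to `(n, d) = 1`, bound `C τ(d)^B ‖β‖² N (log N)^{−A}` for
  `Q ≤ N (log N)^{−2A−4}`), and `…Theorem0a_classic` — (2.2) as printed (`d = 1`).

## Faithfulness

* Theorem 0 (a) as printed (p. 211): "(β_n), n ≤ N, any sequence of complex numbers satisfying
  (A₂). For any `A > 0` there exists `B₁ > 0` such that (2.2) … provided `Q ≤ N (log N)^{−B₁}`",
  constants depending on `A` and `B` (p. 212).  As everywhere in this family of files, (A₂) is
  `BFI.SiegelWalfiszHyp N B Csw β` (real `β` on the dyadic range `n ∼ N`, the family of constants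
  `Csw` explicit), the constants may depend on `A, B, Csw`, "≪ (log N)^{−A}" is rendered "for
  `N ≥ N₁`", and `B₁ = 2A + 4` is given explicitly (the print has `B₁ = A + B₂`).  The residues
  `(a, q) = 1` are enumerated as `l < q`, `(l, q) = 1`.
* (7.2) (p. 222) is (2.2) for the sequence `β_n 1_{(n,d)=1}`; since (A₂) quantifies over the extra
  coprimality condition `(n, d) = 1` precisely for this purpose, we prove the `d`-uniform version
  directly (dependence `τ(d)^B`, from `τ(de) ≤ τ(d)τ(e)`), of which `d = 1` is the printed (2.2).
* Not here: §§3–7 themselves (smoothing, Lemma 2 = truncated Poisson, the evaluations of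
  `𝒮₁, 𝒮₂, 𝒮₃`) and Lemma 1 (Deshouillers–Iwaniec) — the named facts `…Theorem1`, `…Theorem2`
  stay undischarged.

## References

* E. Bombieri, J. B. Friedlander, H. Iwaniec, *Primes in arithmetic progressions to large moduli*,
  Acta Math. 156 (1986), 203–251: §2 Theorem 0 (a) and its proof, pp. 211–212; §7 (7.2), p. 222.
  [BombieriFriedlanderIwaniecActa1986]
-/

open Finset Real
open scoped ArithmeticFunction.sigma

namespace Literature.NumberTheory.Sieve

namespace BFI

/-! ### Parseval on the reduced residue classes (BFI p. 212: "The left-hand side of (2.2) is just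
`S = ∑_{q ≤ Q} φ(q)⁻¹ ∑_{χ ≠ χ₀} |∑_n β_n χ(n)|²`") -/

/-- For `χ ≠ χ₀ (mod q)`, `∑_{l < q, (l,q)=1} χ(l) = 0`. [folklore] -/
theorem sum_filter_coprime_char_eq_zero {q : ℕ} [NeZero q] {χ : DirichletCharacter ℂ q}
    (hχ : χ ≠ 1) : ∑ l ∈ (range q).filter (fun l => l.Coprime q), χ (l : ZMod q) = 0 := by
  rw [Finset.sum_filter_of_ne, LargeSieve.sum_range_eq_sum_zmod (fun a => χ a)]
  · exact MulChar.sum_eq_zero_of_ne_one hχ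
  · intro l _ hl
    by_contra h
    exact hl (MulChar.map_nonunit χ (mt (ZMod.isUnit_iff_coprime l q).1 h))

/-- For a unit `l (mod q)` and a character `χ` with values in `ℂ`: `χ(l̄) = conj χ(l)`. [folklore] -/
theorem char_inv_natCast_eq_conj {q : ℕ} [NeZero q] (χ : DirichletCharacter ℂ q) {l : ℕ}
    (hl : l.Coprime q) : χ ((l : ZMod q)⁻¹) = starRingEnd ℂ (χ (l : ZMod q)) := by
  set u : (ZMod q)ˣ := ZMod.unitOfCoprime l hl with hu
  have hul : (u : ZMod q) = (l : ZMod q) := ZMod.coe_unitOfCoprime l hl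
  rw [← hul, ZMod.inv_coe_unit]
  have h1 : χ ((u⁻¹ : (ZMod q)ˣ) : ZMod q) * χ (u : ZMod q) = 1 := by
    rw [← map_mul, Units.inv_mul, map_one]
  have hne : χ (u : ZMod q) ≠ 0 := by
    intro h; rw [h, mul_zero] at h1; exact zero_ne_one h1
  have h2 : χ ((u⁻¹ : (ZMod q)ˣ) : ZMod q) = (χ (u : ZMod q))⁻¹ :=
    eq_inv_of_mul_eq_one_left h1
  rw [h2]
  exact Complex.inv_eq_conj (χ.unit_norm_eq_one u)

/-- **Collecting the classes**: for `g : ZMod q → ℂ` vanishing off the units,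
`∑_{l < q, (l,q)=1} g(l) · (∑_{n ∈ S, n ≡ l (q)} b_n) = ∑_{n ∈ S} b_n g(n)`. [folklore] -/
theorem sum_filter_coprime_mul_classSum {q : ℕ} [NeZero q] (S : Finset ℕ) (b : ℕ → ℝ)
    (g : ZMod q → ℂ) (hg : ∀ a : ZMod q, ¬ IsUnit a → g a = 0) :
    ∑ l ∈ (range q).filter (fun l => l.Coprime q),
        g (l : ZMod q) * ((∑ n ∈ S, if (n : ZMod q) = (l : ZMod q) then b n else 0 : ℝ) : ℂ) =
      ∑ n ∈ S, (b n : ℂ) * g (n : ZMod q) := by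
  have hswap : ∑ l ∈ (range q).filter (fun l => l.Coprime q),
      g (l : ZMod q) * ((∑ n ∈ S, if (n : ZMod q) = (l : ZMod q) then b n else 0 : ℝ) : ℂ) =
      ∑ n ∈ S, ∑ l ∈ (range q).filter (fun l => l.Coprime q),
        (if (n : ZMod q) = (l : ZMod q) then (b n : ℂ) * g (n : ZMod q) else 0) := by
    rw [Finset.sum_comm]
    refine Finset.sum_congr rfl fun l _ => ?_
    push_cast
    rw [Finset.mul_sum]
    refine Finset.sum_congr rfl fun n _ => ?_
    split_ifs with h
    · rw [h]; ring
    · simp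
  rw [hswap]
  refine Finset.sum_congr rfl fun n _ => ?_
  -- the inner sum over `l`: drop the coprimality filter (terms with `(l,q)>1` vanish), then
  -- pass to `ZMod q`
  rw [Finset.sum_filter_of_ne]
  · rw [LargeSieve.sum_range_eq_sum_zmod
      (fun a => if (n : ZMod q) = a then (b n : ℂ) * g (n : ZMod q) else 0)]
    rw [Finset.sum_ite_eq]
    simp
  · intro l _ hne
    by_contra hl
    apply hne
    split_ifs with h
    · have : ¬ IsUnit ((n : ℕ) : ZMod q) := by
        rw [h]; exact mt (ZMod.isUnit_iff_coprime l q).1 hl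
      rw [hg _ this, mul_zero]
    · rfl

/-- The trivial character detects coprimality: `∑_n b_n χ₀(n) = ∑_{(n,q)=1} b_n`. [folklore] -/
theorem sum_mul_one_char {q : ℕ} [NeZero q] (S : Finset ℕ) (b : ℕ → ℝ) :
    ∑ n ∈ S, (b n : ℂ) * (1 : DirichletCharacter ℂ q) (n : ZMod q) =
      ((∑ n ∈ S, if n.Coprime q then b n else 0 : ℝ) : ℂ) := by
  rw [Complex.ofReal_sum]
  refine Finset.sum_congr rfl fun n _ => ?_
  by_cases h : n.Coprime q
  · rw [MulChar.one_apply ((ZMod.isUnit_iff_coprime n q).2 h), if_pos h, mul_one]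
  · rw [MulChar.map_nonunit _ (mt (ZMod.isUnit_iff_coprime n q).1 h), if_neg h, mul_zero,
      Complex.ofReal_zero]

open scoped Classical in
/-- **Orthogonality** (BFI p. 212): for `(l, q) = 1`, the discrepancy of `b` in the class
`l (mod q)`,
`∑_{n ∈ S, n ≡ l (q)} b_n − φ(q)⁻¹ ∑_{n ∈ S, (n,q)=1} b_n = φ(q)⁻¹ ∑_{χ ≠ χ₀} χ(l̄) ∑_n b_n χ(n)`.
[cite: BombieriFriedlanderIwaniecActa1986, §2 p. 212] -/
theorem classDisc_eq_sum_char {q : ℕ} [NeZero q] (S : Finset ℕ) (b : ℕ → ℝ) {l : ℕ}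
    (hl : l.Coprime q) :
    (((∑ n ∈ S, if (n : ZMod q) = (l : ZMod q) then b n else 0) -
        (∑ n ∈ S, if n.Coprime q then b n else 0) / (Nat.totient q : ℝ) : ℝ) : ℂ) =
      (Nat.totient q : ℂ)⁻¹ * ∑ χ : DirichletCharacter ℂ q,
        (if χ = 1 then 0 else χ ((l : ZMod q)⁻¹) * ∑ n ∈ S, (b n : ℂ) * χ (n : ZMod q)) := by
  have hlu : IsUnit ((l : ℕ) : ZMod q) := (ZMod.isUnit_iff_coprime l q).2 hl
  have hφpos : 0 < (Nat.totient q : ℝ) := by exact_mod_cast Nat.totient_pos.mpr (NeZero.pos q)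
  have hφne : (Nat.totient q : ℂ) ≠ 0 := by exact_mod_cast hφpos.ne'
  -- orthogonality per `n`
  have horth : ∀ n : ℕ, (if (n : ZMod q) = (l : ZMod q) then (b n : ℂ) else 0) =
      (Nat.totient q : ℂ)⁻¹ * ∑ χ : DirichletCharacter ℂ q,
        χ ((l : ZMod q)⁻¹) * χ (n : ZMod q) * (b n : ℂ) := by
    intro n
    rw [← Finset.sum_mul, DirichletCharacter.sum_char_inv_mul_char_eq ℂ hlu]
    by_cases h : (l : ZMod q) = (n : ZMod q)
    · rw [if_pos h, if_pos h.symm, ← mul_assoc, inv_mul_cancel₀ hφne, one_mul]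
    · rw [if_neg h, if_neg (Ne.symm h), zero_mul, mul_zero]
  -- the full class sum
  have hcls : ((∑ n ∈ S, if (n : ZMod q) = (l : ZMod q) then b n else 0 : ℝ) : ℂ) =
      (Nat.totient q : ℂ)⁻¹ * ∑ χ : DirichletCharacter ℂ q,
        χ ((l : ZMod q)⁻¹) * ∑ n ∈ S, (b n : ℂ) * χ (n : ZMod q) := by
    have hcast : ∀ n : ℕ, ((if (n : ZMod q) = (l : ZMod q) then b n else 0 : ℝ) : ℂ) =
        (if (n : ZMod q) = (l : ZMod q) then (b n : ℂ) else 0) := fun n => by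
      split_ifs <;> simp
    rw [Complex.ofReal_sum, Finset.sum_congr rfl fun n _ => (hcast n).trans (horth n),
      ← Finset.mul_sum, Finset.sum_comm]
    congr 1
    refine Finset.sum_congr rfl fun χ _ => ?_
    rw [Finset.mul_sum]
    refine Finset.sum_congr rfl fun n _ => ?_
    ring
  -- isolate the trivial character
  have hsplit : ∑ χ : DirichletCharacter ℂ q,
      χ ((l : ZMod q)⁻¹) * ∑ n ∈ S, (b n : ℂ) * χ (n : ZMod q) =
      ((∑ n ∈ S, if n.Coprime q then b n else 0 : ℝ) : ℂ) +
        ∑ χ : DirichletCharacter ℂ q,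
          (if χ = 1 then 0 else χ ((l : ZMod q)⁻¹) * ∑ n ∈ S, (b n : ℂ) * χ (n : ZMod q)) := by
    have key : ∀ χ : DirichletCharacter ℂ q,
        χ ((l : ZMod q)⁻¹) * ∑ n ∈ S, (b n : ℂ) * χ (n : ZMod q) =
        (if χ = 1 then χ ((l : ZMod q)⁻¹) * ∑ n ∈ S, (b n : ℂ) * χ (n : ZMod q) else 0) +
        (if χ = 1 then 0 else χ ((l : ZMod q)⁻¹) * ∑ n ∈ S, (b n : ℂ) * χ (n : ZMod q)) := by
      intro χ; split_ifs <;> simp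
    rw [Finset.sum_congr rfl fun χ _ => key χ, Finset.sum_add_distrib, Finset.sum_ite_eq']
    simp only [Finset.mem_univ, if_true]
    congr 1
    have hinvu : IsUnit ((l : ZMod q)⁻¹) :=
      IsUnit.of_mul_eq_one_right (l : ZMod q) (ZMod.mul_inv_of_unit _ hlu)
    rw [MulChar.one_apply hinvu, one_mul, sum_mul_one_char]
  rw [Complex.ofReal_sub, Complex.ofReal_div, hcls, hsplit, mul_add]
  push_cast
  field_simp
  ring

open scoped Classical in
/-- **Parseval on the reduced classes** (BFI p. 212: "The left-hand side of (2.2) is just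
`∑_q φ(q)⁻¹ ∑_{χ ≠ χ₀} |∑_n β_n χ(n)|²`"): for `q ≥ 1` and real `b`,
`∑_{l (mod q), (l,q)=1} (∑_{n∈S, n≡l (q)} b_n − φ(q)⁻¹ ∑_{n∈S,(n,q)=1} b_n)²
  = φ(q)⁻¹ ∑_{χ ≠ χ₀} |∑_{n∈S} b_n χ(n)|²`. [cite: BombieriFriedlanderIwaniecActa1986, §2 p. 212] -/
theorem sum_sq_classDisc_eq {q : ℕ} [NeZero q] (S : Finset ℕ) (b : ℕ → ℝ) :
    ∑ l ∈ (range q).filter (fun l => l.Coprime q),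
        ((∑ n ∈ S, if (n : ZMod q) = (l : ZMod q) then b n else 0) -
          (∑ n ∈ S, if n.Coprime q then b n else 0) / (Nat.totient q : ℝ)) ^ 2 =
      (Nat.totient q : ℝ)⁻¹ * ∑ χ : DirichletCharacter ℂ q,
        (if χ = 1 then 0 else ‖∑ n ∈ S, (b n : ℂ) * χ (n : ZMod q)‖ ^ 2) := by
  -- notation
  set L := (range q).filter (fun l => l.Coprime q) with hL
  set D : ℕ → ℝ := fun l => (∑ n ∈ S, if (n : ZMod q) = (l : ZMod q) then b n else 0) -
    (∑ n ∈ S, if n.Coprime q then b n else 0) / (Nat.totient q : ℝ) with hD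
  set T : ℝ := ∑ n ∈ S, if n.Coprime q then b n else 0 with hT
  set Sh : DirichletCharacter ℂ q → ℂ := fun χ => ∑ n ∈ S, (b n : ℂ) * χ (n : ZMod q) with hSh
  have hφpos : 0 < (Nat.totient q : ℝ) := by exact_mod_cast Nat.totient_pos.mpr (NeZero.pos q)
  have hφne : (Nat.totient q : ℂ) ≠ 0 := by exact_mod_cast hφpos.ne'
  -- Step 1: `D(l) = φ⁻¹ ∑_{χ ≠ 1} χ(l̄) Ŝ(χ)` for `l ∈ L`
  have hDl : ∀ l ∈ L, (D l : ℂ) = (Nat.totient q : ℂ)⁻¹ *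
      ∑ χ : DirichletCharacter ℂ q, (if χ = 1 then 0 else χ ((l : ZMod q)⁻¹) * Sh χ) := by
    intro l hl
    have hlq : l.Coprime q := (Finset.mem_filter.1 hl).2
    exact classDisc_eq_sum_char S b hlq
  -- Step 2: `∑_{l ∈ L} D(l) χ(l̄) = conj Ŝ(χ)` for `χ ≠ 1`
  have hdual : ∀ χ : DirichletCharacter ℂ q, χ ≠ 1 →
      ∑ l ∈ L, (D l : ℂ) * χ ((l : ZMod q)⁻¹) = starRingEnd ℂ (Sh χ) := by
    intro χ hχ
    -- replace `χ(l̄)` by `conj χ(l)`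
    have h1 : ∑ l ∈ L, (D l : ℂ) * χ ((l : ZMod q)⁻¹) =
        ∑ l ∈ L, starRingEnd ℂ (χ (l : ZMod q)) * (D l : ℂ) := by
      refine Finset.sum_congr rfl fun l hl => ?_
      rw [char_inv_natCast_eq_conj χ (Finset.mem_filter.1 hl).2, mul_comm]
    rw [h1]
    -- expand `D(l) = clsSum(l) - T/φ`
    have h2 : ∀ l : ℕ, (D l : ℂ) =
        ((∑ n ∈ S, if (n : ZMod q) = (l : ZMod q) then b n else 0 : ℝ) : ℂ) -
          (T : ℂ) / (Nat.totient q : ℂ) := by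
      intro l; simp only [hD, hT]; push_cast; ring
    simp_rw [h2, mul_sub, Finset.sum_sub_distrib]
    -- the class sums collect to `conj Ŝ(χ)`
    have h3 : ∑ l ∈ L, starRingEnd ℂ (χ (l : ZMod q)) *
        ((∑ n ∈ S, if (n : ZMod q) = (l : ZMod q) then b n else 0 : ℝ) : ℂ) =
        starRingEnd ℂ (Sh χ) := by
      rw [hL, sum_filter_coprime_mul_classSum S b (fun a => starRingEnd ℂ (χ a))]
      · simp only [hSh, map_sum, map_mul, Complex.conj_ofReal]
      · intro a ha
        rw [MulChar.map_nonunit χ ha, map_zero]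
    -- the constant term vanishes: `∑_{l ∈ L} conj χ(l) = 0`
    have h4 : ∑ l ∈ L, starRingEnd ℂ (χ (l : ZMod q)) * ((T : ℂ) / (Nat.totient q : ℂ)) = 0 := by
      rw [← Finset.sum_mul, ← map_sum, hL, sum_filter_coprime_char_eq_zero hχ, map_zero, zero_mul]
    rw [h3, h4, sub_zero]
  -- Step 3: assemble in `ℂ`
  have hmain : ((∑ l ∈ L, D l ^ 2 : ℝ) : ℂ) = (Nat.totient q : ℂ)⁻¹ *
      ∑ χ : DirichletCharacter ℂ q, (if χ = 1 then 0 else ((‖Sh χ‖ : ℝ) : ℂ) ^ 2) := by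
    rw [Complex.ofReal_sum]
    calc ∑ l ∈ L, ((D l ^ 2 : ℝ) : ℂ)
        = ∑ l ∈ L, (D l : ℂ) * ((Nat.totient q : ℂ)⁻¹ *
            ∑ χ : DirichletCharacter ℂ q, (if χ = 1 then 0 else χ ((l : ZMod q)⁻¹) * Sh χ)) := by
          refine Finset.sum_congr rfl fun l hl => ?_
          rw [Complex.ofReal_pow, sq, ← hDl l hl]
      _ = (Nat.totient q : ℂ)⁻¹ * ∑ χ : DirichletCharacter ℂ q,
            (if χ = 1 then 0 else Sh χ * ∑ l ∈ L, (D l : ℂ) * χ ((l : ZMod q)⁻¹)) := by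
          -- both sides are the same double sum
          have lhs : ∑ l ∈ L, (D l : ℂ) * ((Nat.totient q : ℂ)⁻¹ *
              ∑ χ : DirichletCharacter ℂ q, (if χ = 1 then 0 else χ ((l : ZMod q)⁻¹) * Sh χ)) =
              ∑ l ∈ L, ∑ χ : DirichletCharacter ℂ q, (if χ = 1 then 0 else
                (Nat.totient q : ℂ)⁻¹ * (Sh χ * ((D l : ℂ) * χ ((l : ZMod q)⁻¹)))) := by
            refine Finset.sum_congr rfl fun l _ => ?_
            rw [Finset.mul_sum, Finset.mul_sum]
            refine Finset.sum_congr rfl fun χ _ => ?_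
            split_ifs <;> ring
          have rhs : (Nat.totient q : ℂ)⁻¹ * ∑ χ : DirichletCharacter ℂ q,
              (if χ = 1 then 0 else Sh χ * ∑ l ∈ L, (D l : ℂ) * χ ((l : ZMod q)⁻¹)) =
              ∑ χ : DirichletCharacter ℂ q, ∑ l ∈ L, (if χ = 1 then 0 else
                (Nat.totient q : ℂ)⁻¹ * (Sh χ * ((D l : ℂ) * χ ((l : ZMod q)⁻¹)))) := by
            rw [Finset.mul_sum]
            refine Finset.sum_congr rfl fun χ _ => ?_
            split_ifs with hχ
            · simp
            · rw [Finset.mul_sum, Finset.mul_sum]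
          rw [lhs, rhs, Finset.sum_comm]
      _ = (Nat.totient q : ℂ)⁻¹ * ∑ χ : DirichletCharacter ℂ q,
            (if χ = 1 then 0 else ((‖Sh χ‖ : ℝ) : ℂ) ^ 2) := by
          congr 1
          refine Finset.sum_congr rfl fun χ _ => ?_
          split_ifs with hχ
          · rfl
          · rw [hdual χ hχ, Complex.mul_conj']
  have hR : ((((Nat.totient q : ℝ)⁻¹ * ∑ χ : DirichletCharacter ℂ q,
      (if χ = 1 then 0 else ‖Sh χ‖ ^ 2) : ℝ)) : ℂ) = (Nat.totient q : ℂ)⁻¹ *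
      ∑ χ : DirichletCharacter ℂ q, (if χ = 1 then 0 else ((‖Sh χ‖ : ℝ) : ℂ) ^ 2) := by
    push_cast
    congr 1
    refine Finset.sum_congr rfl fun χ _ => ?_
    split_ifs <;> simp
  exact Complex.ofReal_injective (hmain.trans hR.symm)


/-! ### The skeleton of Theorem 0 from the character form (BFI (2.4)–(2.7), pp. 212–213) -/

open scoped Classical in
/-- **The skeleton of the proof of Theorem 0, character form** (BFI pp. 212–213, (2.3)–(2.7)),
with every constant explicit and before the choice of the parameters: for `M, N ≥ 0`, real `α`,
`β`, a constant `R ≥ 0` bounding the restricted character sums of `β` to small moduli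
(`|∑_{n ∼ N, (n,e)=1} β_n ψ(n)| ≤ φ(f) R τ(e)^B` for `ψ ≠ χ₀ (mod f)`, `e ≥ 1`; supplied by (A₂),
`Literature.NumberTheory.Sieve.BFI.norm_sum_coprime_mul_char_le_of_SW`), and natural numbers
`F ≥ 1`, `K`, `Qn ≤ F·2^K`,
`∑_{q ≤ Qn} φ(q)⁻¹ ∑_{χ ≠ χ₀ (mod q)} |∑_m α_m χ(m)| |∑_n β_n χ(n)|
  ≤ R F² (M+1)^{1/2} ‖α‖ ∑_{e ≤ Qn} τ(e)^B/φ(e)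
  + [2 √(M+2) √(N+2)/F + 3K (√(M+2) + √(N+2)) + 9 F 2^K] ‖α‖ ‖β‖ ∑_{e ≤ Qn} 1/φ(e)`:
reduction to primitive characters (`T ≤ ∑_e φ(e)⁻¹ (T_e(f ≤ F) + T_e(f > F))`, (2.4)), the
hypothesis on `T_e(f ≤ F)` with the trivial bound `(M+1)^{1/2}‖α‖` on the `α`-side, and the large
sieve on dyadic blocks for `T_e(f > F)` ((2.7)).  This is the estimate behind both parts (a) and
(b) of Theorem 0 (the proof of `Literature.NumberTheory.Sieve.BFI.sum_abs_bilinDisc_le_main`,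
entered one step later). [cite: BombieriFriedlanderIwaniecActa1986, §2 (2.3)–(2.7) pp. 212–213] -/
theorem sum_inv_totient_sum_char_le_main {M N B R : ℝ} {α β : ℕ → ℝ}
    (hM : 0 ≤ M) (hN0 : 0 ≤ N) (hR : 0 ≤ R)
    (hβ : ∀ (f : ℕ) [NeZero f] (ψ : DirichletCharacter ℂ f), ψ ≠ 1 → ∀ e : ℕ, 1 ≤ e →
      ‖∑ n ∈ dyadic N, (if n.Coprime e then (β n : ℂ) else 0) * ψ n‖ ≤
        (Nat.totient f : ℝ) * (R * (σ 0 e : ℝ) ^ B))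
    {F : ℕ} (hF : 1 ≤ F) (K Qn : ℕ) (hK : Qn ≤ F * 2 ^ K) :
    ∑ q ∈ Icc 1 Qn, (Nat.totient q : ℝ)⁻¹ *
        ∑ χ : DirichletCharacter ℂ q, (if χ = 1 then 0 else
          ‖∑ m ∈ dyadic M, (α m : ℂ) * χ m‖ * ‖∑ n ∈ dyadic N, (β n : ℂ) * χ n‖) ≤
      R * (F : ℝ) ^ 2 * (Real.sqrt (M + 1) * Real.sqrt (l2Sq M α)) *
          ∑ e ∈ Icc 1 Qn, (σ 0 e : ℝ) ^ B / (Nat.totient e : ℝ) +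
        (2 * Real.sqrt (M + 2) * Real.sqrt (N + 2) / F +
            3 * K * (Real.sqrt (M + 2) + Real.sqrt (N + 2)) + 9 * F * 2 ^ K) *
          (Real.sqrt (l2Sq M α) * Real.sqrt (l2Sq N β)) *
          ∑ e ∈ Icc 1 Qn, (Nat.totient e : ℝ)⁻¹ := by
  -- notation
  set cα : ℕ → ℕ → ℂ := fun e m => if m.Coprime e then (α m : ℂ) else 0 with hcα
  set cβ : ℕ → ℕ → ℂ := fun e n => if n.Coprime e then (β n : ℂ) else 0 with hcβ
  set H : ℕ → ℕ → ℝ := fun d e => ∑ ψ : DirichletCharacter ℂ d with ψ.IsPrimitive,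
    if d = 1 then 0 else ‖∑ m ∈ dyadic M, cα e m * ψ m‖ * ‖∑ n ∈ dyadic N, cβ e n * ψ n‖
    with hH
  have hH0 : ∀ d e, 0 ≤ H d e := fun d e =>
    Finset.sum_nonneg fun _ _ => by split_ifs <;> positivity
  set Sα : ℝ := Real.sqrt (l2Sq M α) with hSαdef
  set Sβ : ℝ := Real.sqrt (l2Sq N β) with hSβdef
  have hcαle : ∀ e, ∑ m ∈ dyadic M, ‖cα e m‖ ^ 2 ≤ l2Sq M α := by
    intro e
    unfold l2Sq
    refine Finset.sum_le_sum fun m _ => ?_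
    simp only [hcα]
    split_ifs
    · rw [Complex.norm_real, Real.norm_eq_abs, sq_abs]
    · rw [norm_zero, zero_pow two_ne_zero]; positivity
  have hcβle : ∀ e, ∑ n ∈ dyadic N, ‖cβ e n‖ ^ 2 ≤ l2Sq N β := by
    intro e
    unfold l2Sq
    refine Finset.sum_le_sum fun n _ => ?_
    simp only [hcβ]
    split_ifs
    · rw [Complex.norm_real, Real.norm_eq_abs, sq_abs]
    · rw [norm_zero, zero_pow two_ne_zero]; positivity
  -- Steps 2–3: `T ≤ ∑_e φ(e)⁻¹ ∑_d φ(d)⁻¹ H(d, e)`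
  have hT : ∑ q ∈ Icc 1 Qn, (Nat.totient q : ℝ)⁻¹ *
      ∑ χ : DirichletCharacter ℂ q, (if χ = 1 then 0 else
        ‖∑ m ∈ dyadic M, (α m : ℂ) * χ m‖ * ‖∑ n ∈ dyadic N, (β n : ℂ) * χ n‖) ≤
      ∑ e ∈ Icc 1 Qn, (Nat.totient e : ℝ)⁻¹ *
        ∑ d ∈ Icc 1 Qn, (Nat.totient d : ℝ)⁻¹ * H d e := by
    refine le_trans (Finset.sum_le_sum fun q hq => ?_)
      (sum_inv_totient_mul_sum_divisors_le Qn H hH0)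
    have hq1 : 1 ≤ q := (Finset.mem_Icc.1 hq).1
    haveI : NeZero q := ⟨by omega⟩
    refine mul_le_mul_of_nonneg_left ?_ (inv_nonneg.2 (Nat.cast_nonneg _))
    -- (the two sides may carry different `Decidable (χ = 1)` instances)
    refine le_trans (le_of_eq (Finset.sum_congr rfl fun χ _ => by split_ifs <;> rfl))
      ((sum_char_le_sum_primIndex_coprime q M N α β).trans (le_of_eq ?_))
    rw [primIndex, Finset.sum_sigma]
  -- per `e`: split at `F`
  have hsplit : ∀ e : ℕ, ∑ d ∈ Icc 1 Qn, (Nat.totient d : ℝ)⁻¹ * H d e ≤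
      ∑ d ∈ Icc 1 F, (Nat.totient d : ℝ)⁻¹ * H d e +
        ∑ d ∈ Ioc F Qn, (Nat.totient d : ℝ)⁻¹ * H d e := by
    intro e
    rw [← Finset.sum_union]
    · refine Finset.sum_le_sum_of_subset_of_nonneg ?_
        fun d _ _ => mul_nonneg (inv_nonneg.2 (Nat.cast_nonneg _)) (hH0 d e)
      intro d hd
      rw [Finset.mem_union, Finset.mem_Icc, Finset.mem_Ioc]
      rw [Finset.mem_Icc] at hd
      omega
    · rw [Finset.disjoint_left]
      intro d hd1 hd2
      rw [Finset.mem_Icc] at hd1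
      rw [Finset.mem_Ioc] at hd2
      omega
  -- small moduli `d ≤ F`: the hypothesis `hβ`
  have hαside : ∀ (e d : ℕ) (ψ : DirichletCharacter ℂ d),
      ‖∑ m ∈ dyadic M, cα e m * ψ m‖ ≤ Real.sqrt (M + 1) * Sα := by
    intro e d ψ
    refine (norm_sum_mul_char_le_sqrt_card ψ _ _).trans ?_
    exact mul_le_mul (Real.sqrt_le_sqrt (card_dyadic_le_add_one hM)) (Real.sqrt_le_sqrt (hcαle e))
      (Real.sqrt_nonneg _) (Real.sqrt_nonneg _)
  have hsmall : ∀ e ∈ Icc 1 Qn, ∑ d ∈ Icc 1 F, (Nat.totient d : ℝ)⁻¹ * H d e ≤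
      R * (σ 0 e : ℝ) ^ B * (F : ℝ) ^ 2 * (Real.sqrt (M + 1) * Sα) := by
    intro e he
    have he1 : 1 ≤ e := (Finset.mem_Icc.1 he).1
    set Re : ℝ := R * (σ 0 e : ℝ) ^ B with hRe
    have hRe0 : 0 ≤ Re := by positivity
    have hd_term : ∀ d ∈ Icc 1 F, (Nat.totient d : ℝ)⁻¹ * H d e ≤
        (d : ℝ) * (Re * (Real.sqrt (M + 1) * Sα)) := by
      intro d hd
      have hd1 : 1 ≤ d := (Finset.mem_Icc.1 hd).1
      haveI : NeZero d := ⟨by omega⟩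
      have hφ : (0 : ℝ) < Nat.totient d := by exact_mod_cast Nat.totient_pos.2 hd1
      by_cases hd1' : d = 1
      · have : H d e = 0 := by
          simp only [hH]
          exact Finset.sum_eq_zero fun _ _ => if_pos hd1'
        rw [this, mul_zero]
        positivity
      · have hψne : ∀ ψ : DirichletCharacter ℂ d, ψ.IsPrimitive → ψ ≠ 1 := by
          intro ψ hψ h1
          rw [h1, DirichletCharacter.isPrimitive_def, DirichletCharacter.conductor_one] at hψ
          exact hd1' hψ.symm
        have h1 : H d e ≤ ∑ ψ : DirichletCharacter ℂ d with ψ.IsPrimitive,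
            (Real.sqrt (M + 1) * Sα) * ((Nat.totient d : ℝ) * Re) := by
          simp only [hH, if_neg hd1']
          refine Finset.sum_le_sum fun ψ hψ => ?_
          have hψp : ψ.IsPrimitive := (Finset.mem_filter.1 hψ).2
          refine mul_le_mul (hαside e d ψ) ?_ (norm_nonneg _) (by positivity)
          exact hβ d ψ (hψne ψ hψp) e he1
        have hcard : (((Finset.univ : Finset (DirichletCharacter ℂ d)).filter
            (fun ψ : DirichletCharacter ℂ d => ψ.IsPrimitive)).card : ℝ) ≤ d := by
          have h := (Finset.card_filter_le (Finset.univ : Finset (DirichletCharacter ℂ d))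
            (fun ψ : DirichletCharacter ℂ d => ψ.IsPrimitive)).trans_eq
            (Finset.card_univ (α := DirichletCharacter ℂ d))
          rw [← Nat.card_eq_fintype_card,
            DirichletCharacter.card_eq_totient_of_hasEnoughRootsOfUnity ℂ d] at h
          exact_mod_cast h.trans (Nat.totient_le d)
        calc (Nat.totient d : ℝ)⁻¹ * H d e
            ≤ (Nat.totient d : ℝ)⁻¹ * ((((Finset.univ : Finset (DirichletCharacter ℂ d)).filter
                (fun ψ : DirichletCharacter ℂ d => ψ.IsPrimitive)).card : ℝ) *
                ((Real.sqrt (M + 1) * Sα) * ((Nat.totient d : ℝ) * Re))) := by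
              refine mul_le_mul_of_nonneg_left (h1.trans_eq ?_) (inv_nonneg.2 hφ.le)
              rw [Finset.sum_const, nsmul_eq_mul]
          _ = (((Finset.univ : Finset (DirichletCharacter ℂ d)).filter
                (fun ψ : DirichletCharacter ℂ d => ψ.IsPrimitive)).card : ℝ) *
                (Re * (Real.sqrt (M + 1) * Sα)) := by
              field_simp
          _ ≤ (d : ℝ) * (Re * (Real.sqrt (M + 1) * Sα)) :=
              mul_le_mul_of_nonneg_right hcard (by positivity)
    calc ∑ d ∈ Icc 1 F, (Nat.totient d : ℝ)⁻¹ * H d e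
        ≤ ∑ d ∈ Icc 1 F, (d : ℝ) * (Re * (Real.sqrt (M + 1) * Sα)) := Finset.sum_le_sum hd_term
      _ = (∑ d ∈ Icc 1 F, (d : ℝ)) * (Re * (Real.sqrt (M + 1) * Sα)) := by rw [Finset.sum_mul]
      _ ≤ (F : ℝ) ^ 2 * (Re * (Real.sqrt (M + 1) * Sα)) := by
          refine mul_le_mul_of_nonneg_right ?_ (by positivity)
          have h := Finset.sum_le_card_nsmul (Icc 1 F) (fun d : ℕ => (d : ℝ)) F
            (fun d hd => by exact_mod_cast (Finset.mem_Icc.1 hd).2)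
          rw [Nat.card_Icc, Nat.add_sub_cancel, nsmul_eq_mul] at h
          calc ∑ d ∈ Icc 1 F, (d : ℝ) ≤ (F : ℝ) * F := h
            _ = (F : ℝ) ^ 2 := (sq _).symm
      _ = R * (σ 0 e : ℝ) ^ B * (F : ℝ) ^ 2 * (Real.sqrt (M + 1) * Sα) := by rw [hRe]; ring
  -- large moduli `F < d ≤ Qn`: the large sieve
  have hlarge : ∀ e : ℕ, ∑ d ∈ Ioc F Qn, (Nat.totient d : ℝ)⁻¹ * H d e ≤
      (2 * Real.sqrt (M + 2) * Real.sqrt (N + 2) / F +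
          3 * K * (Real.sqrt (M + 2) + Real.sqrt (N + 2)) + 9 * F * 2 ^ K) * (Sα * Sβ) := by
    intro e
    have h1 : ∑ d ∈ Ioc F Qn, (Nat.totient d : ℝ)⁻¹ * H d e ≤
        ∑ d ∈ Ioc F Qn, (Nat.totient d : ℝ)⁻¹ *
          ∑ ψ : DirichletCharacter ℂ d with ψ.IsPrimitive,
            ‖∑ m ∈ dyadic M, cα e m * ψ m‖ * ‖∑ n ∈ dyadic N, cβ e n * ψ n‖ := by
      refine Finset.sum_le_sum fun d _ =>
        mul_le_mul_of_nonneg_left ?_ (inv_nonneg.2 (Nat.cast_nonneg _))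
      simp only [hH]
      refine Finset.sum_le_sum fun ψ _ => ?_
      split_ifs
      · positivity
      · exact le_rfl
    refine h1.trans ((sum_Ioc_inv_totient_mul_le_of_dyadic (cα e) (cβ e) hM hN0 hF K Qn hK).trans
      ?_)
    have hA2 : Real.sqrt (∑ m ∈ dyadic M, ‖cα e m‖ ^ 2) ≤ Sα := Real.sqrt_le_sqrt (hcαle e)
    have hB2 : Real.sqrt (∑ n ∈ dyadic N, ‖cβ e n‖ ^ 2) ≤ Sβ := Real.sqrt_le_sqrt (hcβle e)
    have hF0 : (0 : ℝ) < F := by exact_mod_cast hF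
    refine mul_le_mul_of_nonneg_left (mul_le_mul hA2 hB2 (Real.sqrt_nonneg _)
      (Real.sqrt_nonneg _)) (by positivity)
  -- conclusion
  refine hT.trans ?_
  calc ∑ e ∈ Icc 1 Qn, (Nat.totient e : ℝ)⁻¹ *
          ∑ d ∈ Icc 1 Qn, (Nat.totient d : ℝ)⁻¹ * H d e
      ≤ ∑ e ∈ Icc 1 Qn, (Nat.totient e : ℝ)⁻¹ *
          (R * (σ 0 e : ℝ) ^ B * (F : ℝ) ^ 2 * (Real.sqrt (M + 1) * Sα) +
            (2 * Real.sqrt (M + 2) * Real.sqrt (N + 2) / F +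
              3 * K * (Real.sqrt (M + 2) + Real.sqrt (N + 2)) + 9 * F * 2 ^ K) * (Sα * Sβ)) :=
        Finset.sum_le_sum fun e he => mul_le_mul_of_nonneg_left
          ((hsplit e).trans (add_le_add (hsmall e he) (hlarge e)))
          (inv_nonneg.2 (Nat.cast_nonneg _))
    _ = _ := by
        rw [Finset.mul_sum, Finset.mul_sum, ← Finset.sum_add_distrib]
        refine Finset.sum_congr rfl fun e _ => ?_
        rw [div_eq_mul_inv ((σ 0 e : ℝ) ^ B)]
        ring

end BFI

open BFI

/-! ### Theorem 0 (a): the Barban–Davenport–Halberstam theorem under (A₂) -/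

open Filter in
open scoped Classical in
/-- **Bombieri–Friedlander–Iwaniec 1986, Theorem 0 (a), PROVED** (BFI §2, p. 211: "Let `(β_n)`,
`n ≤ N`, be any sequence of complex numbers satisfying the "Siegel–Walfisz" assumption (A₂). For
any `A > 0`, there exists `B₁ > 0` such that
`∑_{q ≤ Q} ∑_{(a,q)=1} |∑_{n ≡ a (mod q)} β_n − φ(q)⁻¹ ∑_{(n,q)=1} β_n|² ≪ ‖β‖² N (log N)^{−A}`
(2.2) provided that `Q ≤ N (log N)^{−B₁}`"; p. 212: "the implied constants depend on `A` and on
the constant `B` occurring in (A₂)") — the Barban–Davenport–Halberstam theorem for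
(A₂)-sequences.  We prove it in the form (7.2) (p. 222) in which §7 applies it to evaluate `𝒳`
(an extra condition `(n, d) = 1` in both sums, exactly as in (A₂); `d = 1` is (2.2) verbatim, see
`BombieriFriedlanderIwaniecTheorem0a_classic`), for real `β` on `n ∼ N`, (A₂) being
`Literature.NumberTheory.Sieve.BFI.SiegelWalfiszHyp N B Csw β`, with `B₁ = 2A + 4` and the
dependence on `d` explicit: for `A > 0`, `B ≥ 0` and constants `Csw` there are `C, N₁` such that
for `N ≥ N₁`, every real `β` with (A₂), every `d ≥ 1` and every `Q ≤ N (log N)^{−2A−4}`,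
`∑_{1 ≤ q ≤ Q} ∑_{l (mod q), (l,q)=1} (∑_{n∼N, n≡l (q), (n,d)=1} β_n − φ(q)⁻¹ ∑_{n∼N, (n,dq)=1} β_n)²
   ≤ C τ(d)^B ‖β‖² N (log N)^{−A}`.
Proof as printed (p. 212), every constant explicit: Parseval on the reduced classes
(`BFI.sum_sq_classDisc_eq`), reduction to primitive characters, (A₂) for conductors
`≤ F = ⌈(log N)^{A+2}⌉` and the multiplicative large sieve on dyadic blocks of conductors `> F`
(`BFI.sum_inv_totient_sum_char_le_main` with `α = β`, `M = N`), and the numerics of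
`BFI.thm0b_large_numerics`, `BFI.thm0b_small_numerics` at `x = N²`, `ε = 1/2`.
[cite: BombieriFriedlanderIwaniecActa1986, §2 Theorem 0 (a) pp. 211–212; §7 (7.2) p. 222] -/
theorem BombieriFriedlanderIwaniecTheorem0a {A : ℝ} (hA : 0 < A) {B : ℝ} (hB : 0 ≤ B)
    (Csw : ℝ → ℝ) :
    ∃ C N₁ : ℝ, ∀ N : ℝ, N₁ ≤ N → ∀ β : ℕ → ℝ, SiegelWalfiszHyp N B Csw β →
      ∀ d : ℕ, 1 ≤ d → ∀ Q : ℝ, Q ≤ N / Real.log N ^ (2 * A + 4) →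
        ∑ q ∈ Icc 1 ⌊Q⌋₊, ∑ l ∈ (range q).filter (fun l => l.Coprime q),
          ((∑ n ∈ dyadic N, if (n : ZMod q) = (l : ZMod q) ∧ n.Coprime d then β n else 0) -
            (∑ n ∈ dyadic N, if n.Coprime (d * q) then β n else 0) / (Nat.totient q : ℝ)) ^ 2 ≤
          C * (σ 0 d : ℝ) ^ B * l2Sq N β * N / Real.log N ^ A := by
  -- constants depending on `A, B, Csw` only
  set r : ℕ := ⌈B⌉₊ with hr
  obtain ⟨Cτ, hCτ, hτ⟩ := exists_sum_sigma_zero_pow_div_totient_le_real r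
  set c : ℕ := 2 ^ (r + 2) with hc
  set A' : ℝ := 3 * A + 4 + c with hA'def
  have hA' : 0 < A' := by positivity
  set C' : ℝ := max (Csw A') 0 with hC'def
  have hC' : 0 ≤ C' := le_max_right _ _
  -- the threshold `N₁`
  obtain ⟨N₁, hN₁⟩ := Filter.eventually_atTop.1 ((eventually_ge_atTop (9 : ℝ)).and
    ((eventually_log_rpow_le_rpow (A + 3) (by norm_num : (0 : ℝ) < 1 / 2)).and
      (eventually_log_rpow_le_rpow (2 * A + 4) (by norm_num : (0 : ℝ) < 1))))
  refine ⟨408 + 4 * Real.sqrt 2 * C' * Cτ * (1 / 2 : ℝ)⁻¹ ^ A', N₁, ?_⟩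
  intro N hN β hβ d hd Q hQ
  obtain ⟨hN9, hE1, hE2⟩ := hN₁ N hN
  -- `N`, `L = log N`
  have hN1 : (1 : ℝ) ≤ N := by linarith
  have hNpos : 0 < N := by linarith
  set L := Real.log N with hL
  have hL2 : 2 ≤ L := by
    rw [hL, ← Real.log_exp 2]
    refine Real.log_le_log (Real.exp_pos 2) ?_
    have h1 := Real.exp_one_lt_d9
    have h2 : Real.exp 2 = Real.exp 1 * Real.exp 1 := by rw [← Real.exp_add]; norm_num
    nlinarith [Real.exp_pos 1]
  have hL1 : 1 ≤ L := by linarith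
  have hL0 : 0 < L := by linarith
  -- `x = N²`
  have hNx : N ≤ N ^ 2 := by
    rw [sq]; exact le_mul_of_one_le_left hNpos.le hN1
  have hx1 : (1 : ℝ) ≤ N ^ 2 := hN1.trans hNx
  have hhalf : (N ^ 2) ^ (1 / 2 : ℝ) = N := by
    rw [← Real.sqrt_eq_rpow, Real.sqrt_sq hNpos.le]
  have hsqrtx : Real.sqrt (N ^ 2) = N := Real.sqrt_sq hNpos.le
  have hNε : N ≤ (N ^ 2) ^ (1 - (1 / 2 : ℝ)) := by
    rw [show (1 : ℝ) - 1 / 2 = 1 / 2 by norm_num, hhalf]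
  have hE1' : L ^ (A + 3) ≤ (N ^ 2) ^ ((1 / 2 : ℝ) / 2) := by
    rw [show (1 / 2 : ℝ) / 2 = 1 / 2 * (1 / 2) by norm_num, Real.rpow_mul (by positivity), hhalf]
    exact hE1
  have hE2' : L ^ (2 * A + 4) ≤ (N ^ 2) ^ (1 / 2 : ℝ) := by
    rw [hhalf]; simpa only [Real.rpow_one] using hE2
  -- `Qn = ⌊Q⌋`
  set Qn : ℕ := ⌊Q⌋₊ with hQn
  have hLB : 0 < L ^ (2 * A + 4) := Real.rpow_pos_of_pos hL0 _
  have hQn_le : (Qn : ℝ) ≤ N / L ^ (2 * A + 4) := by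
    rcases le_or_gt 0 Q with hQ0 | hQ0
    · exact (Nat.floor_le hQ0).trans hQ
    · rw [hQn, Nat.floor_of_nonpos hQ0.le, Nat.cast_zero]
      positivity
  have hQn_N : (Qn : ℝ) ≤ N :=
    hQn_le.trans (div_le_self hNpos.le (Real.one_le_rpow hL1 (by positivity)))
  have hQn_x : (Qn : ℝ) ≤ (N ^ 2) ^ (1 / 2 : ℝ) / L ^ (2 * A + 4) := by rwa [hhalf]
  -- `F = ⌈L^{A+2}⌉`, `K = log₂ Qn + 1`
  set F : ℕ := ⌈L ^ (A + 2)⌉₊ with hFdef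
  have hLA2 : 1 ≤ L ^ (A + 2) := Real.one_le_rpow hL1 (by positivity)
  have hFge : L ^ (A + 2) ≤ F := Nat.le_ceil _
  have hF1 : 1 ≤ F := by
    have : (1 : ℝ) ≤ F := hLA2.trans hFge
    exact_mod_cast this
  have hFle : (F : ℝ) ≤ 2 * L ^ (A + 2) := by
    have := (Nat.ceil_lt_add_one (by positivity : 0 ≤ L ^ (A + 2))).le
    linarith
  set K : ℕ := Nat.log 2 Qn + 1 with hKdef
  have hK : Qn ≤ F * 2 ^ K :=
    (Nat.lt_pow_succ_log_self one_lt_two Qn).le.trans (Nat.le_mul_of_pos_left _ hF1)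
  have h2K : (2 : ℝ) ^ K ≤ 2 * Qn + 2 := by
    have : (2 : ℕ) ^ K ≤ 2 * Qn + 2 := by
      rcases Nat.eq_zero_or_pos Qn with h0 | hpos
      · simp [hKdef, h0]
      · have := Nat.pow_log_le_self 2 hpos.ne'
        calc 2 ^ K = 2 * 2 ^ Nat.log 2 Qn := by rw [hKdef, pow_succ]; ring
          _ ≤ 2 * Qn + 2 := by omega
    exact_mod_cast this
  have hKL : (K : ℝ) ≤ 2 * L := by
    have hlogle : (Nat.log 2 Qn : ℝ) * 0.6931471803 ≤ L := by
      rcases Nat.eq_zero_or_pos Qn with h0 | hpos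
      · rw [h0, Nat.log_zero_right, Nat.cast_zero, zero_mul]; exact hL0.le
      · have h1 : (2 : ℝ) ^ (Nat.log 2 Qn) ≤ Qn := by
          exact_mod_cast Nat.pow_log_le_self 2 hpos.ne'
        have h3 : (Nat.log 2 Qn : ℝ) * Real.log 2 ≤ Real.log Qn := by
          rw [← Real.log_pow]; exact Real.log_le_log (by positivity) h1
        have h4 : Real.log Qn ≤ L := Real.log_le_log (by exact_mod_cast hpos) hQn_N
        have h5 := Real.log_two_gt_d9
        nlinarith [Nat.cast_nonneg (α := ℝ) (Nat.log 2 Qn)]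
    calc (K : ℝ) = Nat.log 2 Qn + 1 := by rw [hKdef]; push_cast; ring
      _ ≤ 2 * L := by linarith
  -- the sums over `e`
  have hsumτ : ∑ e ∈ Icc 1 Qn, (σ 0 e : ℝ) ^ B / (Nat.totient e : ℝ) ≤ Cτ * L ^ c := by
    set y : ℝ := max (Qn : ℝ) 2 with hy
    have hy2 : 2 ≤ y := le_max_right _ _
    have hyx : y ≤ N := max_le hQn_N (by linarith)
    have hQny : Qn ≤ ⌊y⌋₊ := Nat.le_floor (le_max_left _ _)
    have hτB : ∀ e ∈ Icc 1 Qn, (σ 0 e : ℝ) ^ B / (Nat.totient e : ℝ) ≤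
        (σ 0 e : ℝ) ^ r / (Nat.totient e : ℝ) := by
      intro e he
      have he1 : 1 ≤ e := (Finset.mem_Icc.1 he).1
      have h1 : (1 : ℝ) ≤ σ 0 e := by exact_mod_cast one_le_sigma_zero (by omega)
      refine div_le_div_of_nonneg_right ?_ (Nat.cast_nonneg _)
      calc (σ 0 e : ℝ) ^ B ≤ (σ 0 e : ℝ) ^ (r : ℝ) :=
            Real.rpow_le_rpow_of_exponent_le h1 (Nat.le_ceil B)
        _ = (σ 0 e : ℝ) ^ r := Real.rpow_natCast _ _
    calc ∑ e ∈ Icc 1 Qn, (σ 0 e : ℝ) ^ B / (Nat.totient e : ℝ)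
        ≤ ∑ e ∈ Icc 1 Qn, (σ 0 e : ℝ) ^ r / (Nat.totient e : ℝ) := Finset.sum_le_sum hτB
      _ ≤ ∑ e ∈ Icc 1 ⌊y⌋₊, (σ 0 e : ℝ) ^ r / (Nat.totient e : ℝ) :=
          Finset.sum_le_sum_of_subset_of_nonneg (Finset.Icc_subset_Icc_right hQny)
            fun _ _ _ => by positivity
      _ ≤ Cτ * Real.log y ^ c := hτ y hy2
      _ ≤ Cτ * L ^ c := by
          gcongr
          · exact Real.log_nonneg (by linarith)
          · exact Real.log_le_log (by linarith) hyx
  have hsumφ : ∑ e ∈ Icc 1 Qn, (Nat.totient e : ℝ)⁻¹ ≤ 4 * L ^ 2 := by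
    have h1 := totientInvSum_le Qn
    rw [totientInvSum] at h1
    have hlogQn : Real.log Qn ≤ L := by
      rcases Nat.eq_zero_or_pos Qn with h0 | hpos
      · rw [h0, Nat.cast_zero, Real.log_zero]; exact hL0.le
      · exact Real.log_le_log (by exact_mod_cast hpos) hQn_N
    have hlogQn0 : 0 ≤ Real.log Qn := Real.log_natCast_nonneg Qn
    calc ∑ e ∈ Icc 1 Qn, (Nat.totient e : ℝ)⁻¹ ≤ (1 + Real.log Qn) ^ 2 := h1
      _ ≤ (2 * L) ^ 2 := pow_le_pow_left₀ (by linarith) (by linarith) 2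
      _ = 4 * L ^ 2 := by ring
  -- the restricted sequence `β' = β · 1_{(·, d) = 1}` and its small-conductor bound `R`
  set β' : ℕ → ℝ := fun n => if n.Coprime d then β n else 0 with hβ'def
  have hβpos := hβ.pos_part hN1
  set Sβ : ℝ := Real.sqrt (l2Sq N β) with hSβ
  set Sβ' : ℝ := Real.sqrt (l2Sq N β') with hSβ'
  have hl2le : l2Sq N β' ≤ l2Sq N β := by
    unfold l2Sq
    refine Finset.sum_le_sum fun n _ => ?_
    simp only [hβ'def]
    split_ifs
    · exact le_rfl
    · rw [zero_pow two_ne_zero]; positivity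
  have hSle : Sβ' ≤ Sβ := Real.sqrt_le_sqrt hl2le
  have hSβ0 : 0 ≤ Sβ := Real.sqrt_nonneg _
  have hSβ'0 : 0 ≤ Sβ' := Real.sqrt_nonneg _
  set D : ℝ := Real.log (2 * N) ^ A' with hDdef
  have hD0 : 0 < D := Real.rpow_pos_of_pos (Real.log_pos (by linarith)) _
  have hσd1 : (1 : ℝ) ≤ (σ 0 d : ℝ) ^ B :=
    Real.one_le_rpow (by exact_mod_cast one_le_sigma_zero (by omega)) hB
  set R : ℝ := C' * (σ 0 d : ℝ) ^ B * Sβ * N ^ (1 / 2 : ℝ) / D with hRdef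
  have hR0 : 0 ≤ R := div_nonneg (by positivity) hD0.le
  have hRhyp : ∀ (f : ℕ) [NeZero f] (ψ : DirichletCharacter ℂ f), ψ ≠ 1 → ∀ e : ℕ, 1 ≤ e →
      ‖∑ n ∈ dyadic N, (if n.Coprime e then (β' n : ℂ) else 0) * ψ n‖ ≤
        (Nat.totient f : ℝ) * (R * (σ 0 e : ℝ) ^ B) := by
    intro f _ ψ hψ e he
    have hrew : ∀ n : ℕ, (if n.Coprime e then ((β' n : ℝ) : ℂ) else 0) =
        (if n.Coprime (e * d) then (β n : ℂ) else 0) := by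
      intro n
      simp only [hβ'def]
      by_cases h1 : n.Coprime e
      · by_cases h2 : n.Coprime d
        · rw [if_pos h1, if_pos h2, if_pos (Nat.coprime_mul_iff_right.2 ⟨h1, h2⟩)]
        · rw [if_pos h1, if_neg h2, if_neg (fun h => h2 (Nat.coprime_mul_iff_right.1 h).2),
            Complex.ofReal_zero]
      · rw [if_neg h1, if_neg (fun h => h1 (Nat.coprime_mul_iff_right.1 h).1)]
    rw [Finset.sum_congr rfl fun n _ => by rw [hrew n]]
    have hed : 1 ≤ e * d := Nat.one_le_iff_ne_zero.2 (by positivity)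
    refine (norm_sum_coprime_mul_char_le_of_SW hβpos hA' hψ hed).trans ?_
    refine mul_le_mul_of_nonneg_left ?_ (Nat.cast_nonneg _)
    have hτ1 : ((σ 0 (e * d) : ℕ) : ℝ) ^ B ≤ (σ 0 e : ℝ) ^ B * (σ 0 d : ℝ) ^ B := by
      rw [← Real.mul_rpow (Nat.cast_nonneg _) (Nat.cast_nonneg _)]
      exact Real.rpow_le_rpow (Nat.cast_nonneg _) (by exact_mod_cast sigma_zero_mul_le e d) hB
    change max (Csw A') 0 * Real.sqrt (l2Sq N β) * N ^ (1 / 2 : ℝ) * ((σ 0 (e * d) : ℕ) : ℝ) ^ B /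
        Real.log (2 * N) ^ A' ≤ R * (σ 0 e : ℝ) ^ B
    rw [hRdef]
    calc max (Csw A') 0 * Real.sqrt (l2Sq N β) * N ^ (1 / 2 : ℝ) * ((σ 0 (e * d) : ℕ) : ℝ) ^ B /
          Real.log (2 * N) ^ A'
        ≤ max (Csw A') 0 * Real.sqrt (l2Sq N β) * N ^ (1 / 2 : ℝ) *
            ((σ 0 e : ℝ) ^ B * (σ 0 d : ℝ) ^ B) / Real.log (2 * N) ^ A' :=
          div_le_div_of_nonneg_right (mul_le_mul_of_nonneg_left hτ1 (by positivity)) hD0.le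
      _ = _ := by ring
  -- the skeleton estimate with `α = β = β'`, `M = N`
  have hmain := sum_inv_totient_sum_char_le_main (α := β') (β := β') (B := B) hNpos.le hNpos.le
    hR0 hRhyp hF1 K Qn hK
  -- Parseval, modulus by modulus
  have hpar : ∀ q ∈ Icc 1 Qn, ∑ l ∈ (range q).filter (fun l => l.Coprime q),
      ((∑ n ∈ dyadic N, if (n : ZMod q) = (l : ZMod q) ∧ n.Coprime d then β n else 0) -
        (∑ n ∈ dyadic N, if n.Coprime (d * q) then β n else 0) / (Nat.totient q : ℝ)) ^ 2 =
      (Nat.totient q : ℝ)⁻¹ * ∑ χ : DirichletCharacter ℂ q, (if χ = 1 then 0 else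
        ‖∑ m ∈ dyadic N, (β' m : ℂ) * χ m‖ * ‖∑ n ∈ dyadic N, (β' n : ℂ) * χ n‖) := by
    intro q hq
    have hq1 : 1 ≤ q := (Finset.mem_Icc.1 hq).1
    haveI : NeZero q := ⟨by omega⟩
    have hA1 : ∀ l : ℕ, (∑ n ∈ dyadic N, if (n : ZMod q) = (l : ZMod q) ∧ n.Coprime d then β n else 0) =
        ∑ n ∈ dyadic N, if (n : ZMod q) = (l : ZMod q) then β' n else 0 := by
      intro l
      refine Finset.sum_congr rfl fun n _ => ?_
      simp only [hβ'def]
      split_ifs <;> tauto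
    have hB1 : (∑ n ∈ dyadic N, if n.Coprime (d * q) then β n else 0) =
        ∑ n ∈ dyadic N, if n.Coprime q then β' n else 0 := by
      refine Finset.sum_congr rfl fun n _ => ?_
      simp only [hβ'def]
      by_cases h1 : n.Coprime q
      · by_cases h2 : n.Coprime d
        · rw [if_pos h1, if_pos h2, if_pos (Nat.coprime_mul_iff_right.2 ⟨h2, h1⟩)]
        · rw [if_pos h1, if_neg h2, if_neg (fun h => h2 (Nat.coprime_mul_iff_right.1 h).1)]
      · rw [if_neg h1, if_neg (fun h => h1 (Nat.coprime_mul_iff_right.1 h).2)]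
    calc ∑ l ∈ (range q).filter (fun l => l.Coprime q),
          ((∑ n ∈ dyadic N, if (n : ZMod q) = (l : ZMod q) ∧ n.Coprime d then β n else 0) -
            (∑ n ∈ dyadic N, if n.Coprime (d * q) then β n else 0) / (Nat.totient q : ℝ)) ^ 2
        = ∑ l ∈ (range q).filter (fun l => l.Coprime q),
          ((∑ n ∈ dyadic N, if (n : ZMod q) = (l : ZMod q) then β' n else 0) -
            (∑ n ∈ dyadic N, if n.Coprime q then β' n else 0) / (Nat.totient q : ℝ)) ^ 2 := by
          refine Finset.sum_congr rfl fun l _ => ?_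
          rw [hA1 l, hB1]
      _ = (Nat.totient q : ℝ)⁻¹ * ∑ χ : DirichletCharacter ℂ q,
            (if χ = 1 then 0 else ‖∑ n ∈ dyadic N, (β' n : ℂ) * χ (n : ZMod q)‖ ^ 2) :=
          sum_sq_classDisc_eq (dyadic N) β'
      _ = _ := by
          congr 1
          refine Finset.sum_congr rfl fun χ _ => ?_
          split_ifs
          · rfl
          · rw [sq]
  have hLHS : ∑ q ∈ Icc 1 Qn, ∑ l ∈ (range q).filter (fun l => l.Coprime q),
      ((∑ n ∈ dyadic N, if (n : ZMod q) = (l : ZMod q) ∧ n.Coprime d then β n else 0) -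
        (∑ n ∈ dyadic N, if n.Coprime (d * q) then β n else 0) / (Nat.totient q : ℝ)) ^ 2 =
      ∑ q ∈ Icc 1 Qn, (Nat.totient q : ℝ)⁻¹ * ∑ χ : DirichletCharacter ℂ q,
        (if χ = 1 then 0 else
          ‖∑ m ∈ dyadic N, (β' m : ℂ) * χ m‖ * ‖∑ n ∈ dyadic N, (β' n : ℂ) * χ n‖) :=
    Finset.sum_congr rfl hpar
  -- numerics
  set W : ℝ := Real.sqrt (N ^ 2) / L ^ A with hW
  have hW0 : 0 ≤ W := div_nonneg (Real.sqrt_nonneg _) (Real.rpow_pos_of_pos hL0 _).le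
  have hWN : W = N / L ^ A := by rw [hW, hsqrtx]
  have hlog2N : 1 / 2 * L ≤ Real.log (2 * N) := by
    have : L ≤ Real.log (2 * N) := Real.log_le_log hNpos (by linarith)
    linarith
  have hD : (1 / 2 * L) ^ (3 * A + 4 + c) ≤ D :=
    Real.rpow_le_rpow (by positivity) hlog2N hA'.le
  have hMN2 : (N + 1) * N ≤ 2 * N ^ 2 := by
    have e1 : (N + 1) * N = N ^ 2 + N := by ring
    rw [e1]; linarith [hNx]
  set Λ : ℝ := 2 * Real.sqrt (N + 2) * Real.sqrt (N + 2) / F +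
    3 * K * (Real.sqrt (N + 2) + Real.sqrt (N + 2)) + 9 * F * 2 ^ K with hΛ
  have hF0 : (0 : ℝ) < F := by exact_mod_cast hF1
  have hΛ0 : 0 ≤ Λ := by positivity
  have hlarge : Λ * (4 * L ^ 2) ≤ 408 * W :=
    thm0b_large_numerics (ε := 1 / 2) hx1 (by norm_num) le_rfl hL1 hNpos.le hNpos.le (sq N).symm
      hNx hNx hNε hNε hFge hFle h2K hKL hQn_x hE1' hE2'
  have hsmall : C' * N ^ (1 / 2 : ℝ) / D * (F : ℝ) ^ 2 * Real.sqrt (N + 1) * (Cτ * L ^ c) ≤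
      4 * Real.sqrt 2 * C' * Cτ * (1 / 2 : ℝ)⁻¹ ^ (3 * A + 4 + c) * W :=
    thm0b_small_numerics (ε := 1 / 2) hx1 (by norm_num) hL1 hC' hCτ.le hNpos.le hNpos.le hMN2 hD
      hFle
  -- assembling
  rw [hLHS]
  refine hmain.trans ?_
  have hF2 : (0 : ℝ) ≤ (F : ℝ) ^ 2 := sq_nonneg _
  have hpre1 : 0 ≤ R * (F : ℝ) ^ 2 := mul_nonneg hR0 hF2
  have hsq1 : 0 ≤ Real.sqrt (N + 1) := Real.sqrt_nonneg _
  have hsumτ0 : 0 ≤ ∑ e ∈ Icc 1 Qn, (σ 0 e : ℝ) ^ B / (Nat.totient e : ℝ) :=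
    Finset.sum_nonneg fun _ _ => by positivity
  have hsumφ0 : 0 ≤ ∑ e ∈ Icc 1 Qn, (Nat.totient e : ℝ)⁻¹ :=
    Finset.sum_nonneg fun _ _ => inv_nonneg.2 (Nat.cast_nonneg _)
  have hσB0 : 0 ≤ (σ 0 d : ℝ) ^ B := zero_le_one.trans hσd1
  have hSβsq0 : 0 ≤ Sβ ^ 2 := sq_nonneg _
  have hterm1 : R * (F : ℝ) ^ 2 * (Real.sqrt (N + 1) * Sβ') *
      ∑ e ∈ Icc 1 Qn, (σ 0 e : ℝ) ^ B / (Nat.totient e : ℝ) ≤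
      (σ 0 d : ℝ) ^ B * Sβ ^ 2 *
        (4 * Real.sqrt 2 * C' * Cτ * (1 / 2 : ℝ)⁻¹ ^ (3 * A + 4 + c) * W) := by
    have h1 : R * (F : ℝ) ^ 2 * (Real.sqrt (N + 1) * Sβ') *
        ∑ e ∈ Icc 1 Qn, (σ 0 e : ℝ) ^ B / (Nat.totient e : ℝ) ≤
        R * (F : ℝ) ^ 2 * (Real.sqrt (N + 1) * Sβ) * (Cτ * L ^ c) :=
      mul_le_mul (mul_le_mul_of_nonneg_left (mul_le_mul_of_nonneg_left hSle hsq1) hpre1) hsumτ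
        hsumτ0 (mul_nonneg hpre1 (mul_nonneg hsq1 hSβ0))
    have h2 : R * (F : ℝ) ^ 2 * (Real.sqrt (N + 1) * Sβ) * (Cτ * L ^ c) =
        (σ 0 d : ℝ) ^ B * Sβ ^ 2 *
          (C' * N ^ (1 / 2 : ℝ) / D * (F : ℝ) ^ 2 * Real.sqrt (N + 1) * (Cτ * L ^ c)) := by
      rw [hRdef]; ring
    have h3 := mul_le_mul_of_nonneg_left hsmall (mul_nonneg hσB0 hSβsq0)
    exact h1.trans ((le_of_eq h2).trans h3)
  have hterm2 : Λ * (Sβ' * Sβ') * ∑ e ∈ Icc 1 Qn, (Nat.totient e : ℝ)⁻¹ ≤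
      Sβ ^ 2 * (408 * W) := by
    have h1 : Λ * (Sβ' * Sβ') * ∑ e ∈ Icc 1 Qn, (Nat.totient e : ℝ)⁻¹ ≤
        Λ * (Sβ * Sβ) * (4 * L ^ 2) :=
      mul_le_mul (mul_le_mul_of_nonneg_left (mul_le_mul hSle hSle hSβ'0 hSβ0) hΛ0) hsumφ hsumφ0
        (mul_nonneg hΛ0 (mul_nonneg hSβ0 hSβ0))
    have h2 : Λ * (Sβ * Sβ) * (4 * L ^ 2) = Sβ ^ 2 * (Λ * (4 * L ^ 2)) := by ring
    have h3 := mul_le_mul_of_nonneg_left hlarge hSβsq0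
    exact h1.trans ((le_of_eq h2).trans h3)
  have hSβsq : Sβ ^ 2 = l2Sq N β := Real.sq_sqrt (l2Sq_nonneg N β)
  have hterm3 : Sβ ^ 2 * (408 * W) ≤ (σ 0 d : ℝ) ^ B * (Sβ ^ 2 * (408 * W)) :=
    le_mul_of_one_le_left (mul_nonneg hSβsq0 (mul_nonneg (by norm_num) hW0)) hσd1
  refine (add_le_add hterm1 (hterm2.trans hterm3)).trans (le_of_eq ?_)
  rw [hWN, hSβsq, hA'def]
  ring

/-- **Theorem 0 (a) as printed** ((2.2), p. 211: no extra coprimality condition), the case `d = 1`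
of `BombieriFriedlanderIwaniecTheorem0a`: for `A > 0`, `B ≥ 0`, `Csw` there are `C, N₁` with
`∑_{q ≤ Q} ∑_{(l,q)=1} (∑_{n∼N, n≡l (q)} β_n − φ(q)⁻¹ ∑_{n∼N, (n,q)=1} β_n)² ≤ C ‖β‖² N (log N)^{−A}`
for `N ≥ N₁`, every real `β` with (A₂) and every `Q ≤ N (log N)^{−2A−4}`.
[cite: BombieriFriedlanderIwaniecActa1986, §2 Theorem 0 (a) (2.2) p. 211] -/
theorem BombieriFriedlanderIwaniecTheorem0a_classic {A : ℝ} (hA : 0 < A) {B : ℝ} (hB : 0 ≤ B)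
    (Csw : ℝ → ℝ) :
    ∃ C N₁ : ℝ, ∀ N : ℝ, N₁ ≤ N → ∀ β : ℕ → ℝ, SiegelWalfiszHyp N B Csw β →
      ∀ Q : ℝ, Q ≤ N / Real.log N ^ (2 * A + 4) →
        ∑ q ∈ Icc 1 ⌊Q⌋₊, ∑ l ∈ (range q).filter (fun l => l.Coprime q),
          ((∑ n ∈ dyadic N, if (n : ZMod q) = (l : ZMod q) then β n else 0) -
            (∑ n ∈ dyadic N, if n.Coprime q then β n else 0) / (Nat.totient q : ℝ)) ^ 2 ≤
          C * l2Sq N β * N / Real.log N ^ A := by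
  obtain ⟨C, N₁, h⟩ := BombieriFriedlanderIwaniecTheorem0a hA hB Csw
  refine ⟨C, N₁, fun N hN β hβ Q hQ => ?_⟩
  have h1 := h N hN β hβ 1 le_rfl Q hQ
  simp only [Nat.coprime_one_right_eq_true, and_true, one_mul, ArithmeticFunction.sigma_zero_apply,
    Nat.divisors_one, Finset.card_singleton, Nat.cast_one, Real.one_rpow, mul_one] at h1
  exact h1

end Literature.NumberTheory.Sieve
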